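import Summits.BirchSwinnertonDyer.BirchSwinnertonDyer.Theorems.ByReductionTypeAtTwoSupersingularFlatBlindHondaWronskianSlope
import HarnessLib

/-!
# Route `ByReductionTypeAtTwo` (rung K4), crux `SupersingularRankZeroAtTwo` (item stmt-BirchSwinnertonDyer-19097):
# **THE HONDA RUNG CDF±_H MODULO THE RANK OF `E(ℚ₂(√2))`** — seat `bsd-2adic-ss-1`, GEN 19, LEAD attack (L3), part 5
# (sequel of p810801, p810939, p811031, p811115; line `Lines/odd_blind_package.lean` v2.6.1 18db34093d095bfe, slot 5)

HONEST FRAMING (cell `bsd-2adic`): THEOREMS ONLY; no definition, no named fact, no `sorry`, no instance.  Nothing booked (D-0054);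
BSD is not proved by any of this; RANK₁@2 itself is NOT proved here (the residual: Silverman AEC IV.6.4 / VII.6.3 via the formal logarithm;
absent from the tree at `p = 2`; = the `n = 0` case of -imc's (G1b) `LayerRankInputAtTwo`, `Cruxes/…/D73GeneratorRecipe.lean` v5; odd-`p`
twin = the hypothesis `π` of `Sprung2012.forall_exists_isColemanPair_X_mul_of_surjective`).  bears_on: K4 (item 19097).

`M = E(K_1·K_v)`, `(c₋, c)` a Honda system at two with EVEN parameter `a`, `g` a local lift of the topological generator,
`ev(z) = (z(g·c₁), z(c₋))` for additive `z : M → ℤ₂` (`z(c₁) = λz(c₋) − z(g·c₁)`, `c₀ = μc₋` are forced).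
* §1 `eq_zero_of_apply_eq_zero_of_apply_eq_zero` — `ev` INJECTIVE (clause `inj₁`); `exists_apply_eq_of_apply_eq_two_mul` — image of `ev`
  `2`-SATURATED (clause `sat₁`, decoded coefficientwise by the tree's `eq_zero_of_toIwasawa_cyclotomicOmega_dvd_sum`; `μ` odd); iterated form.
* §2 ★ `independent_of_layerOneRank` — **RANK₁@2 ∧ Honda clauses ∧ (NT) ⟹ (IND₁)** (`c₋`, `g·c₁` independent in `E(K_∞·K_v)/2`): a surjection
  `π : M ↠ ℤ₂²` gives functionals with `ev`-determinant `D ≠ 0` (else `inj₁` kills a coordinate of `π`); `D = unit·2^e`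
  (`PadicInt.unitCoeff_spec`); `α₀π₁ − α₁π₀`, `β₁π₀ − β₀π₁` have `ev = (0, D), (D, 0)`; saturate to the DUAL BASIS `ev = (0,1), (1,0)`; then
  `2y = m₁c₋ + m₂(g·c₁)` gives `2f_B(y) = m₁`, `2f_A(y) = m₂`.  The `p = 2`, layer-one twin of the tree's `honda_rank_of_surjective`.
* §3 ★★ `flatBlindLocalTransversalityHondaOffZeroAtTwo_of_layerOneRank` — over `ℚ`: **RANK₁@2 ⟹ CDF±_H** (via p811115), the conclusion VERBATIM the
  body of the line's rung `OddBlindPackage.FlatBlindLocalTransversalityHondaOffZeroAtTwo`, the hypothesis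
  RANK₁@2 := `∀ W, GoodSS W 2 → ∀ κ cyclotomic, ∀ v ∋ 2, ∃ π : E(ℚ_{1,v}) →+ (Fin 2 → ℤ₂), Surjective π`.
NET (GEN 19): CDF±_H ⟸ (K₈) ⟸ (D₁) ⟸ (IND₁) ⟸ RANK₁@2 — the Honda rung is a kernel theorem MODULO ONE TEXTBOOK RANK FACT at layer one.

References: [Sprung2012] Thm. 2.2, Lemma 2.3, Cor. 2.10 (pp. 1487–1489), Def. 3.1, 5.9, 7.9; [Kobayashi2003] Prop. 8.12; [Silverman2009] AEC
IV.6.4, VII.6.3; tree `Sprung2012/{HondaLevelTwoRelationsProofs, HondaOrbitRankOfSurjectiveProofs}.lean`, p811115.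
-/

set_option autoImplicit false
set_option linter.dupNamespace false

noncomputable section

open scoped Classical NumberField

universe u

namespace Summit.BirchSwinnertonDyer.BirchSwinnertonDyer.Theorems

namespace OddBlindLocal

open NumberField IsDedekindDomain Literature.NumberTheory.EllipticCurves Literature.NumberTheory.GaloisRepresentations
  ZpExtension Literature.NumberTheory.EllipticCurves.Kobayashi2003 Literature.NumberTheory.EllipticCurves.Sprung2017
  Literature.NumberTheory.EllipticCurves.Sprung2012 Literature.NumberTheory.EllipticCurves.Rank1Residual
  Summit.BirchSwinnertonDyer.Rank1Residual.F1Sign2 Summit.BirchSwinnertonDyer.Rank1Residual.Supersingular.BlindLever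

section Generic

variable {K : Type u} [Field K] {κ : ZpExtension K 2}
variable {E : Type u} [Field E] [Algebra K E] {ι : AlgebraicClosure K →ₐ[K] AlgebraicClosure E}
variable {W : WeierstrassCurve K}

/-! ## §0 Level-one orbit sums in coefficient form -/

/-- A two-term sum minus `P_{1,x}(z)`, coefficientwise. [cite: Sprung2012, Def. 3.1 (p. 1489)] -/
theorem sum_sub_pairingSum_one (A : AddSubgroup (localPoints W E)) (g : Field.absoluteGaloisGroup E) (x : localPoints W E)
    (z : A →+ ℤ_[2]) (t : ℕ → ℤ_[2]) :
    (∑ j ∈ Finset.range (2 ^ 1), PowerSeries.C (t j) * (1 + PowerSeries.X) ^ j) - pairingSum W A g 1 x z =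
      ∑ j ∈ Finset.range (2 ^ 1), PowerSeries.C (t j - evalOn W A z (g ^ j • x)) * (1 + PowerSeries.X) ^ j := by
  rw [pairingSum_def, ← Finset.sum_sub_distrib]
  refine Finset.sum_congr rfl fun j _ ↦ ?_
  rw [map_sub, sub_mul]

/-- `C 2 · ∑_{j<2} C(t_j)(1+T)ʲ − P_{1,x}(z) = 0` when `2t_j = z(gʲx)` for `j = 0, 1`. [cite: Sprung2012, Def. 3.1 (p. 1489)] -/
theorem two_mul_sum_sub_pairingSum_one_eq_zero (A : AddSubgroup (localPoints W E)) (g : Field.absoluteGaloisGroup E)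
    (x : localPoints W E) (z : A →+ ℤ_[2]) (t : ℕ → ℤ_[2])
    (h : ∀ j < 2, 2 * t j = evalOn W A z (g ^ j • x)) :
    PowerSeries.C (2 : ℤ_[2]) * (∑ j ∈ Finset.range (2 ^ 1), PowerSeries.C (t j) * (1 + PowerSeries.X) ^ j) -
      pairingSum W A g 1 x z = 0 := by
  rw [pairingSum_def, Finset.mul_sum, ← Finset.sum_sub_distrib]
  refine Finset.sum_eq_zero fun j hj ↦ ?_
  rw [Finset.mem_range, pow_one] at hj
  rw [← mul_assoc, ← map_mul, ← sub_mul, ← map_sub, h j hj, sub_self, map_zero, zero_mul]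

/-- Decoding `ω₁ ∣ ∑_{j<2} C(d_j)(1+T)ʲ`: `d₀ = d₁ = 0`. [cite: Sprung2012, Cor. 2.10 (p. 1489)] [cite: Washington1997, Prop. 7.2] -/
theorem eq_zero_of_omega_one_dvd_sum (d : ℕ → ℤ_[2])
    (h : toIwasawa 2 (cyclotomicOmega 2 1) ∣ ∑ j ∈ Finset.range (2 ^ 1), PowerSeries.C (d j) * (1 + PowerSeries.X) ^ j) :
    d 0 = 0 ∧ d 1 = 0 :=
  ⟨eq_zero_of_toIwasawa_cyclotomicOmega_dvd_sum d h (by norm_num),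
    eq_zero_of_toIwasawa_cyclotomicOmega_dvd_sum d h (by norm_num)⟩

/-! ## §1 `ev(z) = (z(g·c₁), z(c₋))` on `Hom(E(K_1·K_v), ℤ₂)`: injective with `2`-saturated image -/

/-- **`ev` is injective** (clause `inj₁`): a functional on `E(K_1·K_v)` vanishing at `g·c₁` and at `c₋` vanishes (it then vanishes at
`c₁ = λc₋ − g·c₁` and at `c₀ = μc₋`, so both orbit sums `P_{1,c₁}`, `P_{1,c₀}` vanish). [cite: Sprung2012, Thm. 2.2 / Cor. 2.10 (pp. 1487–1489)] -/
theorem eq_zero_of_apply_eq_zero_of_apply_eq_zero {a : ℤ} {g : Field.absoluteGaloisGroup E}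
    (hg : κ.IsTopGenerator (resGalOfEmb ι g)) {cneg : localPoints W E} {c : ℕ → localPoints W E}
    (hH : IsHondaSystemAtTwo κ ι W a g cneg c) (z : localLayerPointsOfEmb κ ι W 1 →+ ℤ_[2])
    (h1 : z ⟨g • c 1, smul_mem_localLayerPointsOfEmb κ ι W 1 g (hH.2.1 1)⟩ = 0)
    (h0 : z ⟨cneg, localLayerPointsOfEmb_mono κ ι W (Nat.zero_le 1) hH.1⟩ = 0) : z = 0 := by
  have h01 : localLayerPointsOfEmb κ ι W 0 ≤ localLayerPointsOfEmb κ ι W 1 := localLayerPointsOfEmb_mono κ ι W (Nat.zero_le 1)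
  have hc1 : c 1 ∈ localLayerPointsOfEmb κ ι W 1 := hH.2.1 1
  have hcneg := h01 hH.1; have hc0eq : c 0 = (a ^ 2 - 2 * a - 1) • cneg := hH.2.2.1
  have hc0mem0 : c 0 ∈ localLayerPointsOfEmb κ ι W 0 := by rw [hc0eq]; exact AddSubgroup.zsmul_mem _ hH.1 _
  have hc0 : c 0 ∈ localLayerPointsOfEmb κ ι W 1 := h01 hc0mem0; have hinj := hH.2.2.2.2.2.2.2.1
  -- `z(c₁) = 0`
  have hzc1 : z ⟨c 1, hc1⟩ = 0 := by
    have e : (⟨c 1, hc1⟩ : localLayerPointsOfEmb κ ι W 1) =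
        (a * (a ^ 2 - 2 * a - 1) + (4 - 2 * a)) • ⟨cneg, hcneg⟩ - ⟨g • c 1, smul_mem_localLayerPointsOfEmb κ ι W 1 g hc1⟩ := by
      apply Subtype.ext
      change c 1 = (a * (a ^ 2 - 2 * a - 1) + (4 - 2 * a)) • cneg - g • c 1
      rw [← add_smul_eq_of_isHondaSystemAtTwo hg hH, add_sub_cancel_right]
    rw [e, map_sub, map_zsmul, h0, h1, smul_zero, sub_zero]
  -- `z(c₀) = 0`
  have hzc0 : z ⟨c 0, hc0⟩ = 0 := by
    have e : (⟨c 0, hc0⟩ : localLayerPointsOfEmb κ ι W 1) = (a ^ 2 - 2 * a - 1) • ⟨cneg, hcneg⟩ := by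
      apply Subtype.ext
      exact hc0eq
    rw [e, map_zsmul, h0, smul_zero]
  have hg2 : g ^ 2 • c 1 = c 1 := by
    have h := pow_mul_smul_of_mem_localLayerPointsOfEmb κ ι W hg hc1 1
    rwa [pow_one, mul_one] at h
  -- both orbit sums vanish
  have hsum : ∀ (x : localPoints W E) (hx : x ∈ localLayerPointsOfEmb κ ι W 1),
      (∀ j : ℕ, z ⟨g ^ j • x, smul_mem_localLayerPointsOfEmb κ ι W 1 _ hx⟩ = 0) →
        pairingSum W (localLayerPointsOfEmb κ ι W 1) g 1 x z = 0 := by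
    intro x hx h
    rw [pairingSum_def]
    refine Finset.sum_eq_zero fun j _ ↦ ?_
    rw [evalOn_of_mem W _ z (smul_mem_localLayerPointsOfEmb κ ι W 1 _ hx), h j, map_zero, zero_mul]
  have horb1 : ∀ j : ℕ, z ⟨g ^ j • c 1, smul_mem_localLayerPointsOfEmb κ ι W 1 _ hc1⟩ = 0 := by
    intro j
    rcases Nat.mod_two_eq_zero_or_one j with hj | hj
    · have e : (⟨g ^ j • c 1, smul_mem_localLayerPointsOfEmb κ ι W 1 _ hc1⟩ : localLayerPointsOfEmb κ ι W 1) = ⟨c 1, hc1⟩ :=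
        Subtype.ext (by change g ^ j • c 1 = c 1; rw [pow_smul_eq_pow_mod_smul_of_mem_layer_one hg hc1 j, hj, pow_zero, one_smul])
      rw [e, hzc1]
    · have e : (⟨g ^ j • c 1, smul_mem_localLayerPointsOfEmb κ ι W 1 _ hc1⟩ : localLayerPointsOfEmb κ ι W 1) =
          ⟨g • c 1, smul_mem_localLayerPointsOfEmb κ ι W 1 g hc1⟩ :=
        Subtype.ext (by change g ^ j • c 1 = g • c 1; rw [pow_smul_eq_pow_mod_smul_of_mem_layer_one hg hc1 j, hj, pow_one])
      rw [e, h1]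
  have horb0 : ∀ j : ℕ, z ⟨g ^ j • c 0, smul_mem_localLayerPointsOfEmb κ ι W 1 _ hc0⟩ = 0 := by
    intro j
    have e : (⟨g ^ j • c 0, smul_mem_localLayerPointsOfEmb κ ι W 1 _ hc0⟩ : localLayerPointsOfEmb κ ι W 1) = ⟨c 0, hc0⟩ :=
      Subtype.ext ((mem_localLayerPointsOfEmb_zero_iff κ ι W _).mp hc0mem0 (g ^ j))
    rw [e, hzc0]
  refine hinj 1 le_rfl z ?_ ?_
  · rw [hsum (c 1) hc1 horb1]; exact dvd_zero _
  · rw [Nat.sub_self, hsum (c 0) hc0 horb0]; exact dvd_zero _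

/-- **The image of `ev` is `2`-saturated** (clause `sat₁`, `a` even): if some functional has `(z(g·c₁), z(c₋)) = (2u, 2w)` then some
functional has `(y(g·c₁), y(c₋)) = (u, w)`.  Decoding: `sat₁` with `A = C(λw − u) + C(u)(1+T)`, `B = C(μw)(1 + (1+T))` returns `y`
with `y(c₁) = λw − u`, `y(g·c₁) = u`, `y(c₀) = μw`; `μ` is odd, so `y(c₋) = w`. [cite: Sprung2012, Thm. 2.2 / Cor. 2.10 (pp. 1487–1489)] -/
theorem exists_apply_eq_of_apply_eq_two_mul {a : ℤ} (hap : (2 : ℤ) ∣ a) {g : Field.absoluteGaloisGroup E}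
    (hg : κ.IsTopGenerator (resGalOfEmb ι g)) {cneg : localPoints W E} {c : ℕ → localPoints W E}
    (hH : IsHondaSystemAtTwo κ ι W a g cneg c) (u w : ℤ_[2])
    (hz : ∃ z : localLayerPointsOfEmb κ ι W 1 →+ ℤ_[2],
      z ⟨g • c 1, smul_mem_localLayerPointsOfEmb κ ι W 1 g (hH.2.1 1)⟩ = 2 * u ∧
        z ⟨cneg, localLayerPointsOfEmb_mono κ ι W (Nat.zero_le 1) hH.1⟩ = 2 * w) :
    ∃ y : localLayerPointsOfEmb κ ι W 1 →+ ℤ_[2],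
      y ⟨g • c 1, smul_mem_localLayerPointsOfEmb κ ι W 1 g (hH.2.1 1)⟩ = u ∧
        y ⟨cneg, localLayerPointsOfEmb_mono κ ι W (Nat.zero_le 1) hH.1⟩ = w := by
  obtain ⟨z, hz1, hz0⟩ := hz
  have h01 : localLayerPointsOfEmb κ ι W 0 ≤ localLayerPointsOfEmb κ ι W 1 := localLayerPointsOfEmb_mono κ ι W (Nat.zero_le 1)
  have hc1 : c 1 ∈ localLayerPointsOfEmb κ ι W 1 := hH.2.1 1
  have hgc1 : g • c 1 ∈ localLayerPointsOfEmb κ ι W 1 := smul_mem_localLayerPointsOfEmb κ ι W 1 g hc1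
  have hcneg := h01 hH.1
  have hc0eq : c 0 = (a ^ 2 - 2 * a - 1) • cneg := hH.2.2.1
  have hc0mem0 : c 0 ∈ localLayerPointsOfEmb κ ι W 0 := by rw [hc0eq]; exact AddSubgroup.zsmul_mem _ hH.1 _
  have hc0 : c 0 ∈ localLayerPointsOfEmb κ ι W 1 := h01 hc0mem0
  have hsat := hH.2.2.2.2.2.2.2.2
  have hg2 : g ^ 2 • c 1 = c 1 := by
    have h := pow_mul_smul_of_mem_localLayerPointsOfEmb κ ι W hg hc1 1
    rwa [pow_one, mul_one] at h
  set Lam : ℤ := a * (a ^ 2 - 2 * a - 1) + (4 - 2 * a) with hLam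
  set Mu : ℤ := a ^ 2 - 2 * a - 1 with hMu
  -- values of `z` at `c₁` and `c₀`
  have hzc1 : z ⟨c 1, hc1⟩ = 2 * ((Lam : ℤ_[2]) * w - u) := by
    have e : (⟨c 1, hc1⟩ : localLayerPointsOfEmb κ ι W 1) = Lam • ⟨cneg, hcneg⟩ - ⟨g • c 1, hgc1⟩ := by
      apply Subtype.ext
      change c 1 = Lam • cneg - g • c 1
      rw [hLam, ← add_smul_eq_of_isHondaSystemAtTwo hg hH, add_sub_cancel_right]
    rw [e, map_sub, map_zsmul, hz0, hz1, zsmul_eq_mul]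
    ring
  have hzc0 : z ⟨c 0, hc0⟩ = 2 * ((Mu : ℤ_[2]) * w) := by
    have e : (⟨c 0, hc0⟩ : localLayerPointsOfEmb κ ι W 1) = Mu • ⟨cneg, hcneg⟩ := Subtype.ext hc0eq
    rw [e, map_zsmul, hz0, zsmul_eq_mul]
    ring
  -- the targets
  let tA : ℕ → ℤ_[2] := fun j ↦ if j = 0 then (Lam : ℤ_[2]) * w - u else u
  let tB : ℕ → ℤ_[2] := fun _ ↦ (Mu : ℤ_[2]) * w
  let A : IwasawaAlgebra 2 := ∑ j ∈ Finset.range (2 ^ 1), PowerSeries.C (tA j) * (1 + PowerSeries.X) ^ j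
  let B : IwasawaAlgebra 2 := ∑ j ∈ Finset.range (2 ^ 1), PowerSeries.C (tB j) * (1 + PowerSeries.X) ^ j
  have hA : toIwasawa 2 (cyclotomicOmega 2 1) ∣
      PowerSeries.C (2 : ℤ_[2]) * A - pairingSum W (localLayerPointsOfEmb κ ι W 1) g 1 (c 1) z := by
    rw [two_mul_sum_sub_pairingSum_one_eq_zero _ g (c 1) z tA ?_]
    · exact dvd_zero _
    intro j hj
    interval_cases j
    · rw [pow_zero, one_smul, evalOn_of_mem W _ z hc1, hzc1]; rfl
    · rw [pow_one, evalOn_of_mem W _ z hgc1, hz1]; rfl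
  have hB : toIwasawa 2 (cyclotomicOmega 2 1) ∣
      PowerSeries.C (2 : ℤ_[2]) * B - pairingSum W (localLayerPointsOfEmb κ ι W 1) g 1 (c (1 - 1)) z := by
    rw [Nat.sub_self, two_mul_sum_sub_pairingSum_one_eq_zero _ g (c 0) z tB ?_]
    · exact dvd_zero _
    intro j _
    rw [(mem_localLayerPointsOfEmb_zero_iff κ ι W _).mp hc0mem0 (g ^ j), evalOn_of_mem W _ z hc0, hzc0]
  obtain ⟨y, hyA, hyB⟩ := hsat 1 le_rfl A B ⟨z, hA, hB⟩
  rw [sum_sub_pairingSum_one] at hyA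
  rw [Nat.sub_self, sum_sub_pairingSum_one] at hyB
  obtain ⟨-, hA1⟩ := eq_zero_of_omega_one_dvd_sum _ hyA
  obtain ⟨hB0, -⟩ := eq_zero_of_omega_one_dvd_sum _ hyB
  -- read off `y(g•c₁) = u` and `y(c₀) = μ w`
  have hy1 : y ⟨g • c 1, hgc1⟩ = u := by
    have h := hA1
    simp only [tA, if_neg (one_ne_zero), pow_one, evalOn_of_mem W _ y hgc1, sub_eq_zero] at h
    exact h.symm
  have hy0' : y ⟨c 0, hc0⟩ = (Mu : ℤ_[2]) * w := by
    have h := hB0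
    simp only [tB, pow_zero, one_smul, evalOn_of_mem W _ y hc0, sub_eq_zero] at h
    exact h.symm
  -- `y(c₀) = μ y(c₋)` and `μ ≠ 0`
  have hMu0 : (Mu : ℤ_[2]) ≠ 0 := by
    obtain ⟨b, hb⟩ := hap
    have hodd : Odd Mu := ⟨2 * b ^ 2 - 2 * b - 1, by rw [hMu, hb]; ring⟩
    have hne : Mu ≠ 0 := fun h ↦ (Int.not_even_iff_odd.mpr hodd) (by rw [h]; exact ⟨0, rfl⟩)
    exact_mod_cast hne
  have hy0 : y ⟨cneg, hcneg⟩ = w := by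
    have e : (⟨c 0, hc0⟩ : localLayerPointsOfEmb κ ι W 1) = Mu • ⟨cneg, hcneg⟩ := Subtype.ext hc0eq
    rw [e, map_zsmul, zsmul_eq_mul] at hy0'
    exact mul_left_cancel₀ hMu0 hy0'
  exact ⟨y, hy1, hy0⟩

/-- Iterated saturation: `(2^e·u, 2^e·w)` in the image of `ev` ⟹ `(u, w)` in the image. [cite: Sprung2012, Cor. 2.10 (p. 1489)] -/
theorem exists_apply_eq_of_apply_eq_pow_mul {a : ℤ} (hap : (2 : ℤ) ∣ a) {g : Field.absoluteGaloisGroup E}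
    (hg : κ.IsTopGenerator (resGalOfEmb ι g)) {cneg : localPoints W E} {c : ℕ → localPoints W E}
    (hH : IsHondaSystemAtTwo κ ι W a g cneg c) (e : ℕ) :
    ∀ (u w : ℤ_[2]),
    (∃ z : localLayerPointsOfEmb κ ι W 1 →+ ℤ_[2],
      z ⟨g • c 1, smul_mem_localLayerPointsOfEmb κ ι W 1 g (hH.2.1 1)⟩ = 2 ^ e * u ∧
        z ⟨cneg, localLayerPointsOfEmb_mono κ ι W (Nat.zero_le 1) hH.1⟩ = 2 ^ e * w) →
    ∃ y : localLayerPointsOfEmb κ ι W 1 →+ ℤ_[2],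
      y ⟨g • c 1, smul_mem_localLayerPointsOfEmb κ ι W 1 g (hH.2.1 1)⟩ = u ∧
        y ⟨cneg, localLayerPointsOfEmb_mono κ ι W (Nat.zero_le 1) hH.1⟩ = w := by
  induction e with
  | zero => intro u w h; simpa only [pow_zero, one_mul] using h
  | succ e ih =>
    intro u w h
    refine exists_apply_eq_of_apply_eq_two_mul hap hg hH u w (ih (2 * u) (2 * w) ?_)
    obtain ⟨z, h1, h0⟩ := h
    exact ⟨z, by rw [h1]; ring, by rw [h0]; ring⟩

/-! ## §2 RANK₁@2 ⟹ (IND₁) -/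

/-- ★ **RANK₁@2 ∧ Honda clauses ∧ (NT) ⟹ (IND₁).**  (NT) no `2`-torsion in `E(K_∞·K_v)`; `(c₋, c)` a Honda system at two with even `a`; `g` a
local lift of the topological generator; `π : E(K_1·K_v) →+ ℤ₂²` SURJECTIVE.  Then `c₋` and `g·c₁` are `𝔽₂`-independent in `E(K_∞·K_v)/2`:
`2y = m₁c₋ + m₂(g·c₁)` forces `m₁, m₂` even.  (Dual basis `f_A, f_B` of `Hom(E(K_1·K_v), ℤ₂)` against `(g·c₁, c₋)` from `π` + §1; `y` lies in
the layer by saturation; `2f_B(y) = m₁`, `2f_A(y) = m₂`.)  The `p = 2`, layer-one twin of the tree's `honda_rank_of_surjective`.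
[cite: Sprung2012, Thm. 2.2, Lemma 2.3, Cor. 2.10 (pp. 1487–1489)] [cite: Silverman2009, VII.6.3] -/
theorem independent_of_layerOneRank
    (hnt : ∀ P ∈ localTowerPointsOfEmb κ ι W, 2 • P = 0 → P = 0)
    {a : ℤ} (hap : (2 : ℤ) ∣ a) {g : Field.absoluteGaloisGroup E} (hg : κ.IsTopGenerator (resGalOfEmb ι g))
    {cneg : localPoints W E} {c : ℕ → localPoints W E} (hH : IsHondaSystemAtTwo κ ι W a g cneg c)
    (hπ : ∃ π : localLayerPointsOfEmb κ ι W 1 →+ (Fin 2 → ℤ_[2]), Function.Surjective π) :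
    ∀ (m₁ m₂ : ℤ) (y : localPoints W E), y ∈ localTowerPointsOfEmb κ ι W →
      2 • y = m₁ • cneg + m₂ • (g • c 1) → (2 : ℤ) ∣ m₁ ∧ (2 : ℤ) ∣ m₂ := by
  have hc1 : c 1 ∈ localLayerPointsOfEmb κ ι W 1 := hH.2.1 1
  have hgc1 : g • c 1 ∈ localLayerPointsOfEmb κ ι W 1 := smul_mem_localLayerPointsOfEmb κ ι W 1 g hc1
  have hcneg : cneg ∈ localLayerPointsOfEmb κ ι W 1 := localLayerPointsOfEmb_mono κ ι W (Nat.zero_le 1) hH.1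
  obtain ⟨π, hπ⟩ := hπ
  -- the coordinate functionals and two preimages
  let p : Fin 2 → (localLayerPointsOfEmb κ ι W 1 →+ ℤ_[2]) := fun i ↦ (Pi.evalAddMonoidHom (fun _ : Fin 2 ↦ ℤ_[2]) i).comp π
  have hp : ∀ i x, p i x = π x i := fun _ _ ↦ rfl
  obtain ⟨mA, hmA⟩ := hπ (Pi.single 0 1); obtain ⟨mB, hmB⟩ := hπ (Pi.single 1 1)
  have hA0 : p 0 mA = 1 := by rw [hp, hmA, Pi.single_eq_same]
  have hA1 : p 1 mA = 0 := by rw [hp, hmA, Pi.single_eq_of_ne (by decide)]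
  have hB0 : p 0 mB = 0 := by rw [hp, hmB, Pi.single_eq_of_ne (by decide)]
  have hB1 : p 1 mB = 1 := by rw [hp, hmB, Pi.single_eq_same]
  -- `ev` of the coordinates and the determinant
  set α₀ := p 0 ⟨g • c 1, hgc1⟩ with hα₀
  set α₁ := p 1 ⟨g • c 1, hgc1⟩ with hα₁
  set β₀ := p 0 ⟨cneg, hcneg⟩ with hβ₀
  set β₁ := p 1 ⟨cneg, hcneg⟩ with hβ₁
  set D := α₀ * β₁ - α₁ * β₀ with hD
  -- the two combinations with `ev = (0, D)` and `(D, 0)`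
  let qB : localLayerPointsOfEmb κ ι W 1 →+ ℤ_[2] := (AddMonoidHom.mulLeft α₀).comp (p 1) - (AddMonoidHom.mulLeft α₁).comp (p 0)
  let qA : localLayerPointsOfEmb κ ι W 1 →+ ℤ_[2] := (AddMonoidHom.mulLeft β₁).comp (p 0) - (AddMonoidHom.mulLeft β₀).comp (p 1)
  have hqB : ∀ x, qB x = α₀ * p 1 x - α₁ * p 0 x := fun _ ↦ rfl
  have hqA : ∀ x, qA x = β₁ * p 0 x - β₀ * p 1 x := fun _ ↦ rfl
  have hqB1 : qB ⟨g • c 1, hgc1⟩ = 0 := by rw [hqB]; ring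
  have hqB0 : qB ⟨cneg, hcneg⟩ = D := by rw [hD]; exact hqB _
  have hqA1 : qA ⟨g • c 1, hgc1⟩ = D := by rw [hqA, hD]; ring
  have hqA0 : qA ⟨cneg, hcneg⟩ = 0 := by rw [hqA]; ring
  -- `D ≠ 0`: else `qB = 0` and `qA = 0` force `α = β = 0`, then `p 0 = 0`, contradicting `p 0 mA = 1`
  have hDne : D ≠ 0 := by
    intro hD0
    have hqB00 : qB = 0 := eq_zero_of_apply_eq_zero_of_apply_eq_zero hg hH qB hqB1 (by rw [hqB0, hD0])
    have hqA00 : qA = 0 := eq_zero_of_apply_eq_zero_of_apply_eq_zero hg hH qA (by rw [hqA1, hD0]) hqA0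
    have e1 : α₀ = 0 := by
      have h : qB mB = 0 := by rw [hqB00, AddMonoidHom.zero_apply]
      rwa [hqB, hB0, hB1, mul_one, mul_zero, sub_zero] at h
    have e2 : α₁ = 0 := by
      have h : qB mA = 0 := by rw [hqB00, AddMonoidHom.zero_apply]
      rwa [hqB, hA0, hA1, mul_zero, mul_one, zero_sub, neg_eq_zero] at h
    have e3 : β₀ = 0 := by
      have h : qA mB = 0 := by rw [hqA00, AddMonoidHom.zero_apply]
      rwa [hqA, hB0, hB1, mul_zero, mul_one, zero_sub, neg_eq_zero] at h
    have hp0 : p 0 = 0 := eq_zero_of_apply_eq_zero_of_apply_eq_zero hg hH (p 0) e1 e3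
    have h : p 0 mA = 0 := by rw [hp0, AddMonoidHom.zero_apply]
    rw [hA0] at h
    exact one_ne_zero h
  -- `D = U · 2^e`
  have hDspec := PadicInt.unitCoeff_spec hDne
  set U : ℤ_[2]ˣ := PadicInt.unitCoeff hDne
  set e : ℕ := D.valuation
  have h2e : ((2 : ℕ) : ℤ_[2]) ^ e = (2 : ℤ_[2]) ^ e := by norm_num
  -- unit-normalise and saturate: the dual basis
  have hcompB : ∀ x, ((AddMonoidHom.mulLeft ((U⁻¹ : ℤ_[2]ˣ) : ℤ_[2])).comp qB) x = ((U⁻¹ : ℤ_[2]ˣ) : ℤ_[2]) * qB x :=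
    fun _ ↦ rfl
  have hcompA : ∀ x, ((AddMonoidHom.mulLeft ((U⁻¹ : ℤ_[2]ˣ) : ℤ_[2])).comp qA) x = ((U⁻¹ : ℤ_[2]ˣ) : ℤ_[2]) * qA x :=
    fun _ ↦ rfl
  obtain ⟨fB, hfB1, hfB0⟩ := exists_apply_eq_of_apply_eq_pow_mul hap hg hH e 0 1
    ⟨(AddMonoidHom.mulLeft ((U⁻¹ : ℤ_[2]ˣ) : ℤ_[2])).comp qB, by
      rw [hcompB, hqB1, mul_zero, mul_zero], by
      rw [hcompB, hqB0, hDspec, ← mul_assoc, Units.inv_mul, one_mul, h2e, mul_one]⟩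
  obtain ⟨fA, hfA1, hfA0⟩ := exists_apply_eq_of_apply_eq_pow_mul hap hg hH e 1 0
    ⟨(AddMonoidHom.mulLeft ((U⁻¹ : ℤ_[2]ˣ) : ℤ_[2])).comp qA, by
      rw [hcompA, hqA1, hDspec, ← mul_assoc, Units.inv_mul, one_mul, h2e, mul_one], by
      rw [hcompA, hqA0, mul_zero, mul_zero]⟩
  -- conclude
  intro m₁ m₂ y hy h2y
  have hyM : y ∈ localLayerPointsOfEmb κ ι W 1 := by
    refine mem_localLayerPointsOfEmb_of_pow_nsmul_mem κ ι W hnt hy (k := 1) ?_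
    rw [pow_one, h2y]
    exact add_mem (AddSubgroup.zsmul_mem _ hcneg _) (AddSubgroup.zsmul_mem _ hgc1 _)
  have e : (2 • ⟨y, hyM⟩ : localLayerPointsOfEmb κ ι W 1) = m₁ • ⟨cneg, hcneg⟩ + m₂ • ⟨g • c 1, hgc1⟩ := Subtype.ext h2y
  have hcast : ∀ m : ℤ, (2 : ℤ_[2]) ∣ (m : ℤ_[2]) → (2 : ℤ) ∣ m := fun m hm ↦ by
    have h := (PadicInt.norm_int_lt_one_iff_dvd (p := 2) m).mp
      ((PadicInt.norm_lt_one_iff_dvd _).mpr (by exact_mod_cast hm))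
    exact_mod_cast h
  constructor
  · apply hcast
    have h := congrArg fB e
    rw [map_nsmul, map_add, map_zsmul, map_zsmul, hfB0, hfB1, smul_zero, add_zero, zsmul_eq_mul, mul_one, nsmul_eq_mul,
      Nat.cast_ofNat] at h
    exact ⟨_, h.symm⟩
  · apply hcast
    have h := congrArg fA e
    rw [map_nsmul, map_add, map_zsmul, map_zsmul, hfA0, hfA1, smul_zero, zero_add, zsmul_eq_mul, mul_one, nsmul_eq_mul,
      Nat.cast_ofNat] at h
    exact ⟨_, h.symm⟩

end Generic

/-! ## §3 Over `ℚ` at `v ∋ 2`: RANK₁@2 ⟹ CDF±_H, the rung's body VERBATIM -/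

section Rat

/-- ★★ **RANK₁@2 ⟹ CDF±_H.**  If for every `W/ℚ` globally minimal with good supersingular reduction at `2`, the cyclotomic `κ` and `v ∋ 2`, the
first layer `E(ℚ_{1,v}) = E(ℚ₂(√2))` of the local tower has an ADDITIVE SURJECTION onto `ℤ₂²` (textbook: `E(K) ⊇ Ê(𝔪_K) ≅ 𝒪_K ≅ ℤ₂^{[K:ℚ₂]}` up to
finite prime-to-2 index, Silverman AEC IV.6.4 / VII.6.3; the `n = 0` case of -imc's (G1b) `LayerRankInputAtTwo`), then slot 5's Honda rung CDF±_H holds: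
RANK₁@2 ⟹ (IND₁) (§2, with (NT) and `2 ∣ a₂` from `GoodSS`) ⟹ (D₁) ⟹ (K₈) ⟹ CDF±_H (p811115, p811031, p810939).  The conclusion is VERBATIM the body
of `OddBlindPackage.FlatBlindLocalTransversalityHondaOffZeroAtTwo` (v2.6.1 :898–925).
[cite: Sprung2012, Thm. 2.2, Lemma 2.3 (p. 1487), Def. 7.9 (p. 1503), Open Problem 7.22 (p. 1505)] [cite: Silverman2009, VII.6.3] -/
theorem flatBlindLocalTransversalityHondaOffZeroAtTwo_of_layerOneRank
    (hR : ∀ (W : WeierstrassCurve ℚ) [W.IsElliptic] [W.IsGloballyMinimal], GoodSS W 2 →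
      ∀ (κ : ZpExtension ℚ 2), κ.IsCyclotomic →
      ∀ (v : HeightOneSpectrum (𝓞 ℚ)), (2 : 𝓞 ℚ) ∈ v.asIdeal →
      ∃ π : localLayerPointsOfEmb κ (closureEmb (K := ℚ) (v.adicCompletion ℚ)) W 1 →+ (Fin 2 → ℤ_[2]), Function.Surjective π) :
    ∀ (W : WeierstrassCurve ℚ) [W.IsElliptic] [W.IsGloballyMinimal],
    ¬ W.HasCM → GoodSS W 2 → W.frobeniusTrace 2 ≠ 0 → W.rootNumber * ZMod.χ₈ (W.conductorNorm ℤ : ZMod 8) = -1 →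
    ∀ (κ : ZpExtension ℚ 2) (γ : Field.absoluteGaloisGroup ℚ),
      κ.IsCyclotomic → κ.IsTopGenerator γ → IsCyclotomicVariable 2 γ →
    ∀ (v : HeightOneSpectrum (𝓞 ℚ)), (2 : 𝓞 ℚ) ∈ v.asIdeal →
    ∀ (g : Field.absoluteGaloisGroup (v.adicCompletion ℚ)) (c : ℕ → localPoints W (v.adicCompletion ℚ)),
      κ.IsTopGenerator (resGalOfEmb (closureEmb (K := ℚ) (v.adicCompletion ℚ)) g) →
      (∀ n, c n ∈ localLayerPointsOfEmb κ (closureEmb (K := ℚ) (v.adicCompletion ℚ)) W n) →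
      (∀ n, 1 ≤ n → localTraceOfEmb κ (closureEmb (K := ℚ) (v.adicCompletion ℚ)) W n (n + 1)
        (c (n + 1)) = W.frobeniusTrace 2 • c n - c (n - 1)) →
      (∀ z₀ : localLayerPointsOfEmb κ (closureEmb (K := ℚ) (v.adicCompletion ℚ)) W 0 →+ ℤ_[2],
        evalOn W (localLayerPointsOfEmb κ (closureEmb (K := ℚ) (v.adicCompletion ℚ)) W 0) z₀ (c 0) = 0 →
          z₀ = 0) →
      (∀ a : ℤ_[2],
        (∃ z₀ : localLayerPointsOfEmb κ (closureEmb (K := ℚ) (v.adicCompletion ℚ)) W 0 →+ ℤ_[2],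
          evalOn W (localLayerPointsOfEmb κ (closureEmb (K := ℚ) (v.adicCompletion ℚ)) W 0) z₀ (c 0) = 2 * a) →
        ∃ y : localLayerPointsOfEmb κ (closureEmb (K := ℚ) (v.adicCompletion ℚ)) W 0 →+ ℤ_[2],
          evalOn W (localLayerPointsOfEmb κ (closureEmb (K := ℚ) (v.adicCompletion ℚ)) W 0) y (c 0) = a) →
      (∃ cneg : localPoints W (v.adicCompletion ℚ),
        Summit.BirchSwinnertonDyer.Rank1Residual.F1Sign2.IsHondaSystemAtTwo κ (closureEmb (K := ℚ) (v.adicCompletion ℚ)) W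
          (W.frobeniusTrace 2) g cneg c) →
      ∀ (y : localPoints W (v.adicCompletion ℚ))
        (hy : y ∈ localLayerPointsOfEmb κ (closureEmb (K := ℚ) (v.adicCompletion ℚ)) W 1), g • y = -y →
        ∀ k : ℕ, (∀ w ∈ localLayerPointsOfEmb κ (closureEmb (K := ℚ) (v.adicCompletion ℚ)) W 1, 2 ^ k • w ≠ y) →
          ∃ z ∈ colemanKer κ (closureEmb (K := ℚ) (v.adicCompletion ℚ)) W (W.frobeniusTrace 2) g c .flat,
            ¬ (2 : ℤ_[2]) ^ (k + 1) ∣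
              z ⟨y, localLayerPointsOfEmb_le_localTowerPointsOfEmb κ (closureEmb (K := ℚ) (v.adicCompletion ℚ)) W 1 hy⟩ :=
  flatBlindLocalTransversalityHondaOffZeroAtTwo_of_independent fun W _ _ hss _ κ hκ v hv _ _ _ hg hH ↦
    independent_of_layerOneRank
      (SignedKatoOffTwo.SignedIntersection.noTwoTorsion_localTowerPointsOfEmb_adicCompletion W hss κ v hv _)
      hss.2 hg hH (hR W hss κ hκ v hv)

end Rat

end OddBlindLocal

end Summit.BirchSwinnertonDyer.BirchSwinnertonDyer.Theorems

end
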